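import Summits.QuantumFields.BalabanUV.T4Continuum.Spine.NE1p.DressedSmallFieldInnerLabelsWitnessLive
import Summits.QuantumFields.BalabanUV.T4Continuum.Spine.NE1p.DressedSmallFieldLinkMu

/-!
# T⁴ programme, spine estimate NE1′ (node O3b/H2) — WITNESS «THE SOURCE-PENCIL INNER-LABEL END FIRES ON W50's DATUM, LINK-FREE ON THE
# TORUS»: this lineage's torus face `DressedSmallFieldLinkMu.muPart_locE_le_of_coresAt_pencil_innerLabels_torus` (the owner's N0x PART 2
# inner-label μ-END with S40.1's (2.27)-link INSIDE and pv22's letters located) APPLIED ONCE BY NAME — a DECIDED applier — on W50's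
# inner-label datum (`termsI` ∕ `GI` ∕ `actI`: ALL admissible inner labels `⟨W, (𝐃, P)⟩` of the footprint, the uncovered cube paid
# by a bond) read along the SOURCE pencil `s ↦ 0 + s • liveTable`; at every REAL source `0 < t ≤ 2` the μ-part is NOT zero

Cell `pub-balaban`, sub-cell `t4`, BINDER-OWNERS row NE1′; crew seat `b2b-balaban-t4-ne1p-formalise-leaf-07` (LEAF PROVER 07, generation
20); crew W-row **W99 ∕ DAG N29zzzzzn, PART 1 of 2** (own-initiative WITNESS follower of this seat's S66 «THE μ-TWIN OF S40» under
R-T61 (ii) — W48 (`DressedSmallFieldFamiliesWitnessMu`, the μ-twin on W45's datum at the FAMILIES index) is the pattern; INTENT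
`HOME/CLAIMS.log` l.24832, BOOKED typer gen 9 **R-T154** l.25118 (cap 260, KERNEL slot); v1.1 = p244597 LANDED l.24982; cross-read **X244** ok
(leaf-10-g13, l.25475, both parts); PART 2 = `DressedSmallFieldOuterLabelsWitnessMu` p245208; v1.2 = this header's row-id tokens ONLY, code
byte-identical).  ADDITIVE — imports W50 PART 2 `Spine/NE1p/DressedSmallFieldInnerLabelsWitnessLive` (leaf-06
g11; → W50 PART 1 → S40.1, W45 → W41 → W35 → W33 → W24, row NE5's `Support/B13HistWitness`) and this seat's S-row
`Spine/NE1p/DressedSmallFieldLinkMu` (→ the owner's N0x PART 2 `DressedSmallFieldLabelCountsMu`, S40.1) ONLY; THEOREMS ONLY (0 `def`,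
0 `def … : Prop`, 0 cite, 0 sorry, 0 `attribute`; one closing `example`); nothing of W50 ∕ N0x ∕ N0u ∕ S40 ∕ W45 ∕ W41 ∕ W35 ∕ W33 ∕
W24 ∕ pv22 is restated — `termsI`, `GI`, `GI_apply`, `actI`, `cI`, `cI_pos`, `pI`, `pI_pos`, `RI`, `sI`, `sI_pos`, `sI_le_one`, `hRR_I`,
`hb₀_I`, `hadm_I`, `actI_real_sub_zero`, `norm_actI_X₀_lt_one` (W50), `δF`∕`κF`∕`α₆F`∕`α₆F_pos`∕`hκ_F`∕`h229_F` (W45), `letterMass_coreW`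
∕ `cM` ∕ `hsmall_mu` (W35), `N₁_coreW` ∕ `ctr0` ∕ `hroom0` ∕ `Acst` ∕ `liveTable` ∕ `integral_incr_pos` (W33), `budget_half` (W41),
`hrate_torus` ∕ `exp_locE_cube` ∕ `X₀` (W24), `torus_consts` (N0o), `K₀_four` (S24) are used BY NAME.

WHY.  W50 fired the owner's N0u inner-label END for the ATTACHED part (table-strength pencil `act 1` vs `act 0`) with the link SUPPLIED
from S40.1's `link_torus`.  The S-row «μ-TWIN OF S40» puts the owner's SOURCE-pencil twin (N0x PART 2: «μ enters (B3) through the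
amplitude ALONE; the count is μ-free») on pv22's torus with the link INSIDE and NO geometry hypothesis.  This file is its decided
applier at the inner-label index — the one index of print's four resummation steps whose μ-twin had no decided inhabitant (families: W48;
components: W84∕W86∕W87 at the bipencil; slot letters: W73∕W81):
* §1 the binders of the torus face MET on W50's datum, LOCATED: **`hAmp_Imu`** (amplitude at the radius `‖0‖ + μ₁‖liveTable‖`, `μ₁ ≤ 2`,
  constant `A := Acst∕2`, W41's `budget_half`; W50's majorant `pI 𝐃·(sI²·1)^{#P}` IS the face's product by `rfl`), `hrate_Imu` ∕
  `hRR_Imu` ∕ `hadm_Imu` (W24's ∕ W50's clauses re-lettered by `torus_consts` ∕ `K₀_four` — `κ₀ = 64·log 162`, `c₁ = 64`,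
  `K₀ = K₀(64,8)`, `ν = 9`); the three remaining located clauses (`64 log 162 + 1 ≤ δF·κF`, `e·K₀(64,8)·64·α₆F ≤ 1`,
  `(A∕2)·e^{5·0+1}·K₀(64,8)·9·64 ≤ 1`) are three-line `have`s inside §2 from W45's `hκ_F`∕`h229_F` and W35's `hsmall_mu` — the crew's
  `…InnerLabelsRefinedWitness.hκ_R` ∕ `…ComponentInnerNestedToriWitness.h229k_I` ∕ `…RecordLabelsTorusWitness.hsmall_mu` state them
  verbatim in OTHER cones (the gate's dedup lint located the coincidence at the v1 dry-run); not imported, not re-declared;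
* §2 **`innerMuEnd_fires`** — the torus face ONCE BY NAME (`h₀ := 0`, `v := liveTable`, `foot`∕`hmono`∕`hlink` GONE — they are inside the
  face), for `0 < μ₀ < μ₁ ≤ 2`, `‖μ‖ ≤ μ₀`; closed form **`innerMuEnd_fires_closed`**: `≤ (K₀(64,8)∕2)·μ₀∕(μ₁ − μ₀)`;
* §3 GENUINE: **`actI_mu_live`** (at every REAL source `0 < t` the increment is `(cI cov + cI unc)·∫ incr (t·r) ≠ 0`) and
  **`innerMuEnd_live`** (`0 < t ≤ 2`; W24's `exp_locE_cube`): the μ-END bounds a quantity that is NOT zero on this datum; the closing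
  `example` recovers W50 PART 2's `actI_live` as the `t = 1` instance.

WORDING OF RECORD: W50's (typer R-T125 (iii) ∕ R-T129) — «(B3-amp) MET because the weights are CHOSEN as N0u's majorant — UNPRINTED for
Bałaban's cores (G-ne9p2-5); (B3-count)'s second step is N0u §2's kernel count, its link leaf-07's kernel (2.27)-lemma on pv22's
CONSTRUCTED torus; «bonds = cubes», `foot = id` and «terms = all admissible inner labels» are OUR toy choices» — now for the source pencil;
`μ₀`, `μ₁` symbolic with `μ₁ ≤ 2` (NE5's class radius), nothing about print's μ-window (w6); the μ-extension is UNPRINTED (GAPS-T4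
C-t4r2-340 (n1)∕(n2)).

HONEST FRAMING.  A DECIDED TOY ([folklore]; 0 sorry; 0 citations; no `def`).  The cores are THEOREM-backed instances of the cell's typed
FORMAT of (2.14) over row NE5's TOY frame — NOT Bałaban's (2.14) terms; (B1b) NOT claimed; (B3-amp) MET by CHOSEN weights — UNPRINTED
for Bałaban's cores (G-ne9p2-5); `RI = 2κ₀+3`, `sI`, `A∕2` are OUR numerals over pv22's located letters; print's `4`∕`5`∕`17` and the
shape `α₆e^{−δκd}·e^{−R(d+5)}·(s²t)^{#P}` are N0u's DISPLAYED (2.27)∕(2.31)–(2.34) print-shape ([Balaban1988RGII] = CMP 116 (1988) pp.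
17–18), TYPE only — no numeral of print is asserted as a fact about Bałaban's densities; 0 binders instantiated on Bałaban's densities;
no wall item; the NE1′ wall wording of record v1.8 (T4-DAG v48–v53) — words, not kind — does NOT move; R-t4r2-Q2 NOT met thereby; NE1′ ⇐
the named binders — NOT proved, NOT printed; spine PROVED 0∕9; count 9 unchanged.  ABSOLUTE RULE honoured: nothing internally minted is
cited; printed loci TYPE∕CONTEXT only.  Rung (B)+1 on ONE finite four-torus — NOT infinite volume, NOT a mass gap, NOT OS on ℝ⁴, NOT
Clay.  HONEST DEPENDENCY: continuum YM on T⁴ ⇐ BetaPertH ∧ nine spine estimates (0/9 proved); BetaPertH ⇐ (D1) ∧ (D4) ∧ CAP+tail;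
G-an2-4 gates asym, D1 and NE2/3/4.
-/

noncomputable section

namespace Summit.QuantumFields.BalabanUV.T4Continuum.NE1p.DressedSmallFieldInnerLabelsWitness

open Set Metric MeasureTheory Complex
open scoped BigOperators
open Literature.MathematicalPhysics.QuantumFieldTheory.Balaban1983to89
open Literature.MathematicalPhysics.QuantumFieldTheory.Balaban1983to89.B12TreeDecay (K₀ K₀_pos)
open Literature.MathematicalPhysics.QuantumFieldTheory.Balaban1983to89.B13Resummation (locE)
open Literature.MathematicalPhysics.QuantumFieldTheory.Balaban1983to89.B13FamilySum (coveringFamilies)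
open Literature.MathematicalPhysics.QuantumFieldTheory.Balaban1983to89.TreeLengthTorus (TPt TDom tsys torusTreeLen)
open Literature.MathematicalPhysics.QuantumFieldTheory.Balaban1983to89.TreeLengthTorusGeometry (tgeometry TTouch)
open Summit.QuantumFields.BalabanUV.T4Continuum.B13HistMeasurable (B13HistM)
open Summit.QuantumFields.BalabanUV.T4Continuum.B13HistWitness (toyFrame)
open Summit.QuantumFields.BalabanUV.T4Continuum.NE1p.DressedSmallFieldTorusWitness (X₀ X₀_val hrate_torus exp_locE_cube)
open Summit.QuantumFields.BalabanUV.T4Continuum.NE1p.DressedSmallFieldGeometry (torus_consts)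
open Summit.QuantumFields.BalabanUV.T4Continuum.NE1p.DressedSmallFieldGeometryFaces (K₀_four)
open Summit.QuantumFields.BalabanUV.T4Continuum.NE1p.DressedSmallFieldCoresWitness (E1 liveTable norm_liveTable_le coreW N₁_coreW ctr0
  hroom0 Acst Acst_pos incr integral_incr_pos)
open Summit.QuantumFields.BalabanUV.T4Continuum.NE1p.DressedSmallFieldCoresMassWitness (letterMass_coreW cM hsmall_mu)
open Summit.QuantumFields.BalabanUV.T4Continuum.NE1p.DressedSmallFieldDepCoresWitness (budget_half)
open Summit.QuantumFields.BalabanUV.T4Continuum.NE1p.DressedSmallFieldFamiliesWitness (δF κF α₆F α₆F_pos hκ_F h229_F)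
open Summit.QuantumFields.BalabanUV.T4Continuum.NE1p.DressedSmallFieldLinkMu (muPart_locE_le_of_coresAt_pencil_innerLabels_torus)

section Torus
variable (N : ℕ) [NeZero N] (r : ℝ) (hr : 0 ≤ r)

/-! ## §1 The source-pencil amplitude clause at `A := A∕2` and the located clauses of the link-free torus face -/

/-- **`hAmp` ALONG THE SOURCE PENCIL** (`h₀ = 0`, `v = liveTable`, `‖s‖ < μ₁ ≤ 2`, constant `A := Acst∕2`) [decided toy], in the LITERAL
binder shape of the link-free torus face `muPart_locE_le_of_coresAt_pencil_innerLabels_torus` at NE5's toy letters `(mq, bq, N₀) =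
(1, 0, 1)`: `maj(l)·|cM r∕2|·√(2π)·e^{r·μ₁‖liveTable‖} ≤ (A∕2)·maj(l)` (W35 `letterMass_coreW`, W33 `N₁_coreW`, W41 `budget_half`
with `u = μ₁‖liveTable‖ ≤ 2`); the majorant is W50's `pI 𝐃·(sI²·1)^{#P}` read in the torus currency (`torusTreeLen`). [folklore] -/
theorem hAmp_Imu {μ₁ : ℝ} (hμ₁ : μ₁ ≤ 2) (k : ℕ) :
    ∀ Z : (tsys 4 N).Dom, Z.1 ⊆ (X₀ N).1 → ∀ l ∈ termsI N Z,
      (GI N r hr k l k).lam.real univ *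
          ((GI N r hr k l k).wB * (fun (_ : ℕ) (_ : Label N) (_ : ℕ) => (1 : ℝ)) k l k *
            Real.exp ((fun (_ : ℕ) (_ : Label N) (_ : ℕ) => (0 : ℝ)) k l k)) *
          (Real.pi / ((fun (_ : ℕ) (_ : Label N) (_ : ℕ) => (1 : ℝ)) k l k / 2)) ^ (Module.finrank ℝ E1 / 2 : ℝ) *
        Real.exp ((GI N r hr k l k).N₁ * (‖(0 : B13HistM toyFrame)‖ + μ₁ * ‖liveTable‖)) ≤
      Acst / 2 * ((∏ Y ∈ l.2.1, (α₆F * Real.exp (-(δF * κF * torusTreeLen Y.1)) *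
        Real.exp (-(RI N * (torusTreeLen Y.1 + 5))))) * (sI N ^ 2 * 1) ^ l.2.2.card) := by
  intro Z _ l _
  simp only [GI_apply]
  rw [letterMass_coreW, N₁_coreW, norm_zero, zero_add]
  have hp : 0 ≤ pI N l.2.1 * (sI N ^ 2 * 1) ^ l.2.2.card := by have := pI_pos N l.2.1; have := sI_pos N; positivity
  have hT : μ₁ * ‖liveTable‖ ≤ 2 := (mul_le_mul hμ₁ norm_liveTable_le (norm_nonneg _) (by norm_num)).trans (by norm_num)
  have hb := budget_half r hr hT
  have hpI : (∏ Y ∈ l.2.1, (α₆F * Real.exp (-(δF * κF * torusTreeLen Y.1)) * Real.exp (-(RI N * (torusTreeLen Y.1 + 5))))) =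
      pI N l.2.1 := rfl
  rw [hpI]
  unfold cI
  rw [abs_mul, abs_of_nonneg hp]
  calc |cM r / 2| * (pI N l.2.1 * (sI N ^ 2 * 1) ^ l.2.2.card) * Real.sqrt (2 * Real.pi) * Real.exp (r * (μ₁ * ‖liveTable‖))
      = (pI N l.2.1 * (sI N ^ 2 * 1) ^ l.2.2.card) * (|cM r / 2| * Real.sqrt (2 * Real.pi) * Real.exp (r * (μ₁ * ‖liveTable‖))) := by
        ring
    _ ≤ (pI N l.2.1 * (sI N ^ 2 * 1) ^ l.2.2.card) * (Acst / 2) := mul_le_mul_of_nonneg_left hb hp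
    _ = Acst / 2 * (pI N l.2.1 * (sI N ^ 2 * 1) ^ l.2.2.card) := by ring

/-- The located step rate: `0 + 2·(64 log 162) + 2 ≤ 2κ₀ + 2` (W24's `hrate_torus` in pv22's numerals). [arith] -/
theorem hrate_Imu : (0 : ℝ) + 2 * (64 * Real.log 162) + 2 ≤ 2 * (tgeometry 4 N).κ₀ + 2 := by
  have h := hrate_torus N; rw [(torus_consts N).2.1] at h ⊢; exact h

/-- The located rate bookkeeping `hRR` of the torus face: `2κ₀ + 2 ≤ RI − 64·(e^{RI·5}·sI·e^{1·1})` (W50's `hRR_I` at `c₁ = 64`). [arith] -/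
theorem hRR_Imu : 2 * (tgeometry 4 N).κ₀ + 2 ≤ RI N - 64 * (Real.exp (RI N * 5) * sI N * Real.exp (1 * 1)) := by
  have h := hRR_I N; rw [(torus_consts N).2.2] at h; exact h

/-- W50's admissibility `hadm_I` in the torus face's footprint spelling (`(tgeometry 4 N).cubes Z` IS `Z.1`). [folklore] -/
theorem hadm_Imu : ∀ Z : (tsys 4 N).Dom, ∀ l ∈ termsI N Z, l.1 ⊆ Z.1 ∧
    l.2.1 ∈ coveringFamilies Finset.univ (fun Y : (tsys 4 N).Dom => Y.1) (Z.1 \ l.1) ∧ l.2.2 ⊆ l.1 ∧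
      l.1.card ≤ 2 * l.2.2.card :=
  hadm_I N

/-! ## §2 THE μ-TWIN FIRES: the LINK-FREE torus face of N0x P2's inner-label μ-END applied ONCE BY NAME (a decided applier) -/

open Classical in
/-- **`muPart_locE_le_of_coresAt_pencil_innerLabels_torus` FIRES ON W50's DATUM** [decided toy]: the SAME activity `actI` (all admissible
inner labels of the footprint, label-indexed cores `GI`) read along the SOURCE pencil `s ↦ 0 + s • liveTable` (`h₀ := 0`, `v := liveTable`,
`‖s‖ < μ₁ ≤ 2` so the pencil stays in NE5's class of history radius `2`), `hAmp_Imu` at `A := A∕2`, the located clauses (inline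
`hκ`∕`h229`∕`hsmall`) ∕ `hrate_Imu` ∕ `hRR_Imu`, bonds READ AS CUBES (`bondsOf := id`, `b₀ := 1`, W50's `hb₀_I`), `s := sI`, `t := 1`,
W50's `hadm_I`, W33's `ctr0`∕`hroom0`, NE5's toy letters INLINE; NO link binder, NO geometry hypothesis (the torus face carries S40.1's
(2.27)-link inside); for `0 < μ₀ < μ₁`, `‖μ‖ ≤ μ₀`.  Conclusion LITERAL, in the crew's torus currency. [folklore] -/
theorem innerMuEnd_fires {μ₁ μ₀ : ℝ} {μ : ℂ} (hμ₁ : μ₁ ≤ 2) (h0 : 0 < μ₀) (h01 : μ₀ < μ₁) (hμ : ‖μ‖ ≤ μ₀) (k : ℕ) :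
    ‖locE (TTouch (d := 4) (N := N)) (fun Z : (tsys 4 N).Dom => Z.1) (actI N r hr k μ) (X₀ N).1 -
        locE (TTouch (d := 4) (N := N)) (fun Z : (tsys 4 N).Dom => Z.1) (actI N r hr k 0) (X₀ N).1‖ ≤
      Real.exp 1 * 9 * 64 * K₀ 64 8 ^ 2 * (Acst / 2) * Real.exp (-(0 * torusTreeLen (X₀ N).1)) * (μ₀ / (μ₁ - μ₀)) := by
  -- the three LOCATED clauses of the torus face on this datum (the crew's landed one-liners `…InnerLabelsRefinedWitness.hκ_R`,
  -- `…ComponentInnerNestedToriWitness.h229k_I`, `…RecordLabelsTorusWitness.hsmall_mu` state them verbatim in other cones; re-derived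
  -- here in three lines from W45's `hκ_F` ∕ `h229_F` and W35's `hsmall_mu` so that the imports stay at two — the gate's dedup lint
  -- located the coincidence, nothing of those modules is restated as a declaration)
  have hκ : 64 * Real.log 162 + 1 ≤ δF * κF := by have h := hκ_F N; rw [(torus_consts N).2.1] at h; exact h
  have h229 : Real.exp 1 * K₀ 64 8 * 64 * α₆F ≤ 1 := by have h := h229_F N; rw [(torus_consts N).2.2, K₀_four] at h; exact h
  have hsmall : Acst / 2 * Real.exp (5 * 0 + 1) * K₀ 64 8 * 9 * 64 ≤ 1 := by
    have h := hsmall_mu N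
    rw [(torus_consts N).1, (torus_consts N).2.2, K₀_four] at h
    calc Acst / 2 * Real.exp (5 * 0 + 1) * K₀ 64 8 * 9 * 64 = (1 / 2) * (Acst * Real.exp (0 + 1) * K₀ 64 8 * 9 * 64) := by
          rw [show (5 : ℝ) * 0 + 1 = 0 + 1 by ring]; ring
      _ ≤ (1 / 2) * 1 := by gcongr
      _ ≤ 1 := by norm_num
  exact muPart_locE_le_of_coresAt_pencil_innerLabels_torus (GI N r hr)
    (Win := Set.univ) (ctr := ctr0) (ROp := fun _ => 1) (RHist := fun _ => 2) (R' := fun _ => 2)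
    (mq := fun _ _ _ => 1) (bq := fun _ _ _ => 0) (N₀ := fun _ _ _ => 1)
    hroom0 (fun _ _ _ _ _ _ _ => one_pos)
    (fun _ _ _ _ _ _ _ => ⟨fun _ _ => aestronglyMeasurable_const, fun _ => differentiableOn_const _, fun _ _ _ => by
      show ‖(1 : ℂ)‖ ≤ 1; rw [norm_one]⟩)
    (fun _ _ _ _ _ _ _ => ⟨fun _ _ => (Complex.measurable_ofReal.comp (measurable_snd.norm.pow_const 2)).aestronglyMeasurable,
      fun _ _ => differentiableOn_const _, fun _ _ _ v => by
        show 1 * ‖v‖ ^ 2 - 0 ≤ (((‖v‖ ^ 2 : ℝ) : ℂ)).re; rw [Complex.ofReal_re]; simp⟩)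
    (g := fun _ => 0) (Set.mem_univ _) (U := ()) (o := 0) (h₀ := 0) (v := liveTable) (μ₁ := μ₁)
    (by show ‖(0 : ℂ) - 0‖ ≤ 1; simp)
    (by show ‖(0 : B13HistM toyFrame) - 0‖ + μ₁ * ‖liveTable‖ ≤ 2; rw [sub_zero, norm_zero, zero_add];
        exact (mul_le_mul hμ₁ norm_liveTable_le (norm_nonneg _) (by norm_num)).trans (by norm_num))
    (emb := fun _ => k) (fun _ => rfl) (terms := termsI N) (act := actI N r hr k) (fun _ _ _ => rfl)
    (A := Acst / 2) (Rkp := 2 * (tgeometry 4 N).κ₀ + 2) (r₁ := 0) (X₀ N) (sμ := μ)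
    (by have := Acst_pos; positivity) le_rfl (hrate_Imu N) hsmall
    (fun W => W) (δ := δF) (κ := κF) (α₆ := α₆F) (R := RI N) (b₀ := 1) (s := sI N) (t := 1) α₆F_pos.le hκ h229
    (sI_pos N).le (sI_le_one N) zero_le_one (hb₀_I N) (hRR_Imu N) (hadm_Imu N) (hAmp_Imu N r hr hμ₁ k) h0 h01 hμ

open Classical in
/-- … in CLOSED FORM: the μ-part is `≤ (K₀(64,8)∕2)·μ₀∕(μ₁ − μ₀)`. [folklore] -/
theorem innerMuEnd_fires_closed {μ₁ μ₀ : ℝ} {μ : ℂ} (hμ₁ : μ₁ ≤ 2) (h0 : 0 < μ₀) (h01 : μ₀ < μ₁) (hμ : ‖μ‖ ≤ μ₀) (k : ℕ) :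
    ‖locE (TTouch (d := 4) (N := N)) (fun Z : (tsys 4 N).Dom => Z.1) (actI N r hr k μ) (X₀ N).1 -
        locE (TTouch (d := 4) (N := N)) (fun Z : (tsys 4 N).Dom => Z.1) (actI N r hr k 0) (X₀ N).1‖ ≤
      K₀ 64 8 / 2 * (μ₀ / (μ₁ - μ₀)) := by
  refine (innerMuEnd_fires N r hr hμ₁ h0 h01 hμ k).trans (le_of_eq ?_)
  rw [zero_mul, neg_zero, Real.exp_zero, mul_one]
  unfold Acst
  have hK := K₀_pos (64 : ℝ) 8
  have he := Real.exp_pos 1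
  field_simp

/-! ## §3 GENUINE: the μ-part of the activity at a REAL positive source is NOT zero -/

/-- **THE μ-PART AT A REAL POSITIVE SOURCE IS NOT ZERO** [decided toy]: `actI t X₀ − actI 0 X₀ = (cI cov + cI unc)·∫ incr (t·r)`
(W50's `actI_real_sub_zero`) with both weights positive and `∫ incr (t·r) > 0` for `0 < t`, `0 < r` (W33's `integral_incr_pos`). [folklore] -/
theorem actI_mu_live (hr0 : 0 < r) {t : ℝ} (ht : 0 < t) (k : ℕ) : actI N r hr k (t : ℂ) (X₀ N) ≠ actI N r hr k 0 (X₀ N) := by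
  intro h
  have h0 := sub_eq_zero.2 h
  rw [actI_real_sub_zero] at h0
  rcases mul_eq_zero.1 h0 with hc | hI
  · have hpos : 0 < cI N r ⟨∅, ({X₀ N}, ∅)⟩ + cI N r ⟨{0}, (∅, {0})⟩ := add_pos (cI_pos N r _) (cI_pos N r _)
    exact hpos.ne' (by exact_mod_cast hc)
  · exact (integral_incr_pos (t * r) (mul_pos ht hr0)).ne' (by exact_mod_cast hI)

open Classical in
/-- **THE μ-END's BOUNDED QUANTITY IS NOT ZERO** for a REAL source `0 < t ≤ 2` [decided toy]: equal dressed outputs on the cube would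
give equal activities at `X₀` (W24's `exp_locE_cube` BY NAME; W50's `norm_actI_X₀_lt_one` for `‖t‖ ≤ 2`), contradicting `actI_mu_live`.
[folklore] -/
theorem innerMuEnd_live (hr0 : 0 < r) {t : ℝ} (ht : 0 < t) (ht2 : t ≤ 2) (k : ℕ) :
    locE (TTouch (d := 4) (N := N)) (fun Z : (tsys 4 N).Dom => Z.1) (actI N r hr k (t : ℂ)) (X₀ N).1 ≠
      locE (TTouch (d := 4) (N := N)) (fun Z : (tsys 4 N).Dom => Z.1) (actI N r hr k 0) (X₀ N).1 := by
  intro h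
  have ht' : ‖(t : ℂ)‖ ≤ 2 := by rw [Complex.norm_real, Real.norm_eq_abs, abs_of_pos ht]; exact ht2
  have h1 := exp_locE_cube N (w := actI N r hr k (t : ℂ)) (norm_actI_X₀_lt_one N r hr k ht')
  have h0 := exp_locE_cube N (w := actI N r hr k 0) (norm_actI_X₀_lt_one N r hr k (by simp))
  have h' : cexp (locE (TTouch (d := 4) (N := N)) (fun Z : (tsys 4 N).Dom => Z.1) (actI N r hr k (t : ℂ)) {0}) =
      cexp (locE (TTouch (d := 4) (N := N)) (fun Z : (tsys 4 N).Dom => Z.1) (actI N r hr k 0) {0}) := by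
    rw [X₀_val] at h; exact congrArg cexp h
  rw [h1, h0, add_right_inj] at h'
  exact actI_mu_live N r hr hr0 ht k h'

/-- SANITY: W50 PART 2's table-strength liveness `actI_live` is the `t = 1` instance of the source-pencil liveness. -/
example (hr0 : 0 < r) (k : ℕ) : actI N r hr k 1 (X₀ N) ≠ actI N r hr k 0 (X₀ N) := by
  simpa using actI_mu_live N r hr hr0 one_pos k

end Torus

end Summit.QuantumFields.BalabanUV.T4Continuum.NE1p.DressedSmallFieldInnerLabelsWitness

end
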